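import Summits.Parity.GeneralizedHardyLittlewood.Theses.PrimeDeterminantCells
-- buildfix 2026-08-19: the fibration lemma's module is no longer imported transitively by the route file
import Summits.Parity.GeneralizedHardyLittlewood.Theorems.LeeYangFibresFibrationLemmaFinal
import Summits.Parity.GeneralizedHardyLittlewood.Theorems.PairsToGHL.Negative.UnboundedSiegelZeros
import Literature.Barriers.Parity.SiegelZeroDichotomyNoSiegelZeros

/-!
# Crux `CentralCellsDimOne` (stmt-Parity-9537) — crux-strategist sketch
# (planner-cstrat-stmt-Parity-9537-s2-0, 2026-08-17)

Typed companions of `STRATEGY-CENSUS.md` (workfile `Cruxes/CentralCellsDimOne/STRATEGY-CENSUS.md`):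
the POSITION of the node inside route `PrimeDeterminantCells` (rev 10/11: `closes : CentralCellsDimOne →
AlternatingSeesawLawR → GeneralizedHardyLittlewood`), the strengthening `S⁺` (all windows) with its
down-arrow, the typed `t`-slice split with its glue, and the negation by-product (Siegel chain through
`closes`).  Nothing here is a line or a stub; every `theorem` is a real proof (no `sorry`).

Notation of the census: `C` = `CentralCellsDimOne` (the crux), `Law` = `AlternatingSeesawLawR` (rank-3 crux
of the same route), `D₁` = `DimOneInline` below (Green–Tao Conj. 1.2 at `d = 1`, shift-uniform — verbatim the
hypothesis of the tree's fibration lemma `Theorems.FibrationGlue.generalizedHardyLittlewood_of_dimOne` and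
the unfolded body of `DicksonFibration.DimOne`, stmt-Parity-0819), `S` = `GeneralizedHardyLittlewood`.
-/

namespace Summit.Parity.GeneralizedHardyLittlewood.Cruxes.CentralCellsDimOne.Strategist

open Literature.NumberTheory.Sieve Literature.Barriers.Parity
open Summit.Parity.GeneralizedHardyLittlewood.Theses
open scoped BigOperators Classical

noncomputable section

/-! ## §0 Position: modulo the Law the crux IS the summit conjunct -/

/-- `D₁`: the one-dimensional Green–Tao conjecture, all `t`, shift-uniform (the hypothesis of the fibration
lemma, verbatim). [cite: GreenTao2010, Conj. 1.2] -/
def DimOneInline : Prop :=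
  ∀ (t L : ℕ), 1 ≤ t → ∀ ε : ℝ, 0 < ε → ∃ N₀ : ℕ, ∀ N : ℕ, N₀ ≤ N →
    ∀ Φ : Fin t → AffLinForm 1, IsNondegenerateSystem Φ → affLinSize Φ N ≤ L →
      ∀ K : Set (Fin 1 → ℝ), Convex ℝ K → K ⊆ realBox 1 N →
        |vonMangoldtSum Φ K N - archFactor Φ K * singularProduct Φ| ≤ ε * (N : ℝ)

/-- `S ↔ D₁` (→ is the specialisation `d := 1`; ← is the PROVED, Theses-free fibration lemma).
[cite: GreenTao2010, remark after Conj. 1.2] -/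
theorem ghl_iff_dimOneInline : _root_.GeneralizedHardyLittlewood ↔ DimOneInline := by
  refine ⟨fun h t L ht ε hε => ?_, fun h => Theorems.FibrationGlue.generalizedHardyLittlewood_of_dimOne h⟩
  obtain ⟨N₀, hN₀⟩ := h 1 t L le_rfl ht ε hε
  refine ⟨N₀, fun N hN Ψ hΨ hL K hK hKN => ?_⟩
  simpa using hN₀ N hN Ψ hΨ hL K hK hKN

-- buildfix 2026-08-19: `closes` (route rev ≥ 12) takes a third binder `FibrationLift`, discharged here and below
-- by the tree's Theses-free fibration lemma, exactly as `Theorems/PrimeDeterminantCellsCentralCellsModLaw.lean` does.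
/-- The route's own arrow: `C ∧ Law → D₁` (through the certified deciding theorem `closes`). [folklore] -/
theorem dimOne_of_cells_of_law (hC : PrimeDeterminantCells.CentralCellsDimOne)
    (hL : PrimeDeterminantCells.AlternatingSeesawLawR) : DimOneInline :=
  ghl_iff_dimOneInline.mp (PrimeDeterminantCells.closes hC hL
    (fun h => Theorems.FibrationGlue.generalizedHardyLittlewood_of_dimOne h))

/-- **The converse seam**: `Law → D₁ → C`.  Given the Law, the `d = 1` statement feeds the Law's antecedent
(every `t' < t`) and supplies `|S − M| ≤ ε N` at `t` itself, so the cells' two-term value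
`(1/3)^t logᵗN (M + (−1)^t (S − M))` collapses to the Hardy–Littlewood value `(1/3)^t logᵗN · M`.  Hence
modulo the route's rank-3 crux the rank-2 crux is EQUIVALENT to the summit conjunct (`cells_iff_ghl_of_law`):
there is no reduction slack between `C` and `S` other than the Law itself. [folklore] -/
theorem cells_of_law_of_dimOne (hL : PrimeDeterminantCells.AlternatingSeesawLawR) (hD : DimOneInline) :
    PrimeDeterminantCells.CentralCellsDimOne := by
  intro t L ht ε hε
  obtain ⟨N₁, hN₁⟩ := hL t L ht (fun t' L' ht' _ => hD t' L' ht') (ε / 2) (by positivity)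
  obtain ⟨N₂, hN₂⟩ := hD t L ht (ε / 2) (by positivity)
  refine ⟨max N₁ N₂, fun N hN Ψ hΨ hΨL K hK hKN => ?_⟩
  have h1 := hN₁ N (le_trans (le_max_left _ _) hN) Ψ hΨ hΨL K hK hKN
  have h2 := hN₂ N (le_trans (le_max_right _ _) hN) Ψ hΨ hΨL K hK hKN
  have hlog : 0 ≤ Real.log (N : ℝ) := Real.log_natCast_nonneg N
  have hNnn : (0 : ℝ) ≤ (N : ℝ) := Nat.cast_nonneg N
  have hH0 : 0 ≤ (1 / 3 : ℝ) ^ t * Real.log (N : ℝ) ^ t := by positivity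
  have hH1 : (1 / 3 : ℝ) ^ t * Real.log (N : ℝ) ^ t ≤ Real.log (N : ℝ) ^ t := by
    have h13 : (1 / 3 : ℝ) ^ t ≤ 1 := pow_le_one₀ (by norm_num) (by norm_num)
    have hlt : 0 ≤ Real.log (N : ℝ) ^ t := pow_nonneg hlog t
    calc (1 / 3 : ℝ) ^ t * Real.log (N : ℝ) ^ t ≤ 1 * Real.log (N : ℝ) ^ t :=
          mul_le_mul_of_nonneg_right h13 hlt
      _ = Real.log (N : ℝ) ^ t := one_mul _
  -- abstract real-number core: `C` cell sum, `Hc` the scale, `Mm` main term, `Ss` the prime sum, `e` = ε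
  have key : ∀ (Cc Hc Mm Ss e : ℝ), 0 ≤ Hc → Hc ≤ Real.log (N : ℝ) ^ t → 0 ≤ e →
      |Cc - Hc * (Mm + (-1 : ℝ) ^ t * (Ss - Mm))| ≤ e / 2 * (N : ℝ) * Real.log (N : ℝ) ^ t →
      |Ss - Mm| ≤ e / 2 * (N : ℝ) → |Cc - Hc * Mm| ≤ e * (N : ℝ) * Real.log (N : ℝ) ^ t := by
    intro Cc Hc Mm Ss e hHc0 hHc1 he hC hSM
    have eq : Cc - Hc * Mm =
        (Cc - Hc * (Mm + (-1 : ℝ) ^ t * (Ss - Mm))) + Hc * ((-1 : ℝ) ^ t * (Ss - Mm)) := by ring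
    rw [eq]
    have hsecond : |Hc * ((-1 : ℝ) ^ t * (Ss - Mm))| ≤ Real.log (N : ℝ) ^ t * (e / 2 * (N : ℝ)) := by
      rw [abs_mul, abs_of_nonneg hHc0, abs_mul, abs_neg_one_pow, one_mul]
      exact mul_le_mul hHc1 hSM (abs_nonneg _) (pow_nonneg hlog t)
    calc |(Cc - Hc * (Mm + (-1 : ℝ) ^ t * (Ss - Mm))) + Hc * ((-1 : ℝ) ^ t * (Ss - Mm))|
        ≤ |Cc - Hc * (Mm + (-1 : ℝ) ^ t * (Ss - Mm))| + |Hc * ((-1 : ℝ) ^ t * (Ss - Mm))| :=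
          abs_add_le _ _
      _ ≤ e / 2 * (N : ℝ) * Real.log (N : ℝ) ^ t + Real.log (N : ℝ) ^ t * (e / 2 * (N : ℝ)) :=
          add_le_add hC hsecond
      _ = e * (N : ℝ) * Real.log (N : ℝ) ^ t := by ring
  exact key _ _ _ _ _ hH0 hH1 hε.le h1 h2

/-- Hence, given the Law, `C ↔ D₁` … [folklore] -/
theorem cells_iff_dimOne_of_law (hL : PrimeDeterminantCells.AlternatingSeesawLawR) :
    PrimeDeterminantCells.CentralCellsDimOne ↔ DimOneInline :=
  ⟨fun hC => dimOne_of_cells_of_law hC hL, cells_of_law_of_dimOne hL⟩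

/-- … and `C ↔ S`: modulo the route's other crux, the rank-2 crux is the sub-problem Statement. [folklore] -/
theorem cells_iff_ghl_of_law (hL : PrimeDeterminantCells.AlternatingSeesawLawR) :
    PrimeDeterminantCells.CentralCellsDimOne ↔ _root_.GeneralizedHardyLittlewood :=
  (cells_iff_dimOne_of_law hL).trans ghl_iff_dimOneInline.symm

/-! ## §N Negation by-product: through `closes`, the exceptional zero refutes `C ∧ Law` -/

/-- Modulo the vendored Matomäki–Merikoski Theorem 1.3: Siegel zeros of unbounded quality refute the
conjunction of the route's two cruxes (system `(n, n + 2q)`, `N = q^{10}`; the tree's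
`PairsToGHL.Negative.not_generalizedHardyLittlewood_of_unboundedSiegelZeros` composed with `closes`).  In the
illusory world the balanced weight `W` pretends to be `W♭(1 + χ)`, so the CELLS along `(n, n+2q)` double
while the Law keeps holding — the natural disproof target on this crux is therefore
`CentralCellsDimOne_false_without_NoSiegelZeros`, which needs an MM-type theorem for balanced `E₂` weights
(not in print; census §Negation N1). [cite: MatomakiMerikoski2023, Theorem 1.3] -/
theorem not_cells_and_law_of_unboundedSiegelZeros (hMM : MatomakiMerikoski2023_pairCorrelation)
    (hU : UnboundedSiegelZeros) (hL : PrimeDeterminantCells.AlternatingSeesawLawR) :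
    ¬ PrimeDeterminantCells.CentralCellsDimOne := fun hC =>
  Theorems.PairsToGHL.Negative.not_generalizedHardyLittlewood_of_unboundedSiegelZeros hMM hU
    (PrimeDeterminantCells.closes hC hL
    (fun h => Theorems.FibrationGlue.generalizedHardyLittlewood_of_dimOne h))

/-- Hence (mod MM Thm 1.3) closing BOTH cruxes of the route is a Landau–Siegel theorem. [cite: MatomakiMerikoski2023, Theorem 1.3] -/
theorem noSiegelZeros_of_cells_of_law (hMM : MatomakiMerikoski2023_pairCorrelation)
    (hC : PrimeDeterminantCells.CentralCellsDimOne) (hL : PrimeDeterminantCells.AlternatingSeesawLawR) :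
    Literature.NumberTheory.LFunctions.NoSiegelZeros :=
  noSiegelZeros_of_not_unboundedSiegelZeros fun hU => not_cells_and_law_of_unboundedSiegelZeros hMM hU hL hC

/-! ## §S Strengthen: `S⁺` = the cells for EVERY window `[m^β, m^γ]`, `0 < β ≤ γ < 1` -/

/-- `S⁺` (all windows): for every fixed window `[β, γ] ⊂ (0,1)` the cells
`Σ_{n∈K∩ℤ} Π_i W_{β,γ}(ψ_i(n))`, `W_{β,γ}(m) = Σ_{ab=m, m^β ≤ a ≤ m^γ} Λ(a)Λ(b)`, have the value
`(γ − β)^t logᵗN · β_∞Πβ_p + o(N logᵗN)` uniformly (window mass `γ − β` per coordinate: the Hardy–Littlewood /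
Bombieri prediction, `u = log a/log m` uniformly distributed).  The census explains why the added rigidity
(differentiability in `β`, Bombieri's vector structure in the factor-size variable) buys nothing for THIS
step: the `β`-derivative of a cell is a LOPSIDED cell (one factor of exact size `m^β`) — a prime-tuple
statement again — and the only structure theorem for the `u`-density of a level-1 sequence is the seesaw
`∝ (2 − s)`, i.e. the route's Law. [folklore] -/
def CellsAllWindows : Prop :=
  ∀ (β γ : ℝ), 0 < β → β ≤ γ → γ < 1 →
  ∀ (t L : ℕ), 1 ≤ t → ∀ ε : ℝ, 0 < ε → ∃ N₀ : ℕ, ∀ N : ℕ, N₀ ≤ N →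
    ∀ Ψ : Fin t → AffLinForm 1, IsNondegenerateSystem Ψ → affLinSize Ψ N ≤ L →
      ∀ K : Set (Fin 1 → ℝ), Convex ℝ K → K ⊆ realBox 1 N →
        |(∑ n ∈ (latticeBox 1 N).filter (fun n => realPoint n ∈ K),
            ∏ i, ∑ ab ∈ (Nat.divisorsAntidiagonal ((Ψ i).eval n).toNat).filter
              (fun ab : ℕ × ℕ => ((((Ψ i).eval n).toNat : ℕ) : ℝ) ^ β ≤ (ab.1 : ℝ) ∧
                (ab.1 : ℝ) ≤ ((((Ψ i).eval n).toNat : ℕ) : ℝ) ^ γ),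
              ArithmeticFunction.vonMangoldt ab.1 * ArithmeticFunction.vonMangoldt ab.2) -
          (γ - β) ^ t * Real.log N ^ t * (archFactor Ψ K * singularProduct Ψ)| ≤
          ε * (N : ℝ) * Real.log N ^ t

/-- `S⁺ → C` (the central window `β = 1/3`, `γ = 2/3`, mass `2/3 − 1/3 = 1/3`). [folklore] -/
theorem cells_of_allWindows (h : CellsAllWindows) : PrimeDeterminantCells.CentralCellsDimOne := by
  intro t L ht ε hε
  have h' := h (1 / 3) (2 / 3) (by norm_num) (by norm_num) (by norm_num) t L ht ε hε
  have e : (2 / 3 - 1 / 3 : ℝ) = 1 / 3 := by norm_num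
  simp only [e] at h'
  exact h'

/-! ## §D Decomposition: the `t`-slices (typed; glue by case split; NOT filed — census §Decomposition D-c) -/

/-- The crux at ONE value of `t` (all `L`). [folklore] -/
def CellsAt (t : ℕ) : Prop :=
  ∀ L : ℕ, ∀ ε : ℝ, 0 < ε → ∃ N₀ : ℕ, ∀ N : ℕ, N₀ ≤ N →
    ∀ Ψ : Fin t → AffLinForm 1, IsNondegenerateSystem Ψ → affLinSize Ψ N ≤ L →
      ∀ K : Set (Fin 1 → ℝ), Convex ℝ K → K ⊆ realBox 1 N →
        |(∑ n ∈ (latticeBox 1 N).filter (fun n => realPoint n ∈ K),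
            ∏ i, ∑ ab ∈ (Nat.divisorsAntidiagonal ((Ψ i).eval n).toNat).filter
              (fun ab : ℕ × ℕ => ((((Ψ i).eval n).toNat : ℕ) : ℝ) ^ (1 / 3 : ℝ) ≤ (ab.1 : ℝ) ∧
                (ab.1 : ℝ) ≤ ((((Ψ i).eval n).toNat : ℕ) : ℝ) ^ (2 / 3 : ℝ)),
              ArithmeticFunction.vonMangoldt ab.1 * ArithmeticFunction.vonMangoldt ab.2) -
          (1 / 3 : ℝ) ^ t * Real.log N ^ t * (archFactor Ψ K * singularProduct Ψ)| ≤
          ε * (N : ℝ) * Real.log N ^ t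

/-- `C ↔ ∀ t ≥ 1, CellsAt t` (reordering of binders only). [folklore] -/
theorem cells_iff_forall_cellsAt :
    PrimeDeterminantCells.CentralCellsDimOne ↔ ∀ t : ℕ, 1 ≤ t → CellsAt t :=
  ⟨fun h t ht L ε hε => h t L ht ε hε, fun h t L ht ε hε => h t ht L ε hε⟩

/-- Slice `t ≤ T`. [folklore] -/
def CellsUpTo (T : ℕ) : Prop := ∀ t : ℕ, 1 ≤ t → t ≤ T → CellsAt t

/-- Slice `t > T`. [folklore] -/
def CellsAbove (T : ℕ) : Prop := ∀ t : ℕ, 1 ≤ t → T < t → CellsAt t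

/-- Glue of the `t`-slice split: `CellsUpTo T → CellsAbove T → C` (case split; trivial seam).  At `T = 1`
the first piece is PNT-level (balanced semiprimes in AP segments, Siegel–Walfisz uniformity in the shift —
= birth's S1+S2+S3 at `t = 1`); at `T = 2` it contains the twin cell `CentralPrimeDeterminant`; no slice
`t ≥ 2` is owned by a tool and `CellsAt 2 ⇏ CellsAt 3` (census D-c). [folklore] -/
theorem cells_of_slices (T : ℕ) (h₁ : CellsUpTo T) (h₂ : CellsAbove T) :
    PrimeDeterminantCells.CentralCellsDimOne := by
  rw [cells_iff_forall_cellsAt]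
  intro t ht
  rcases Nat.lt_or_ge T t with hlt | hge
  · exact h₂ t ht hlt
  · exact h₁ t ht hge

/-- Conversely every slice is a consequence of the crux. [folklore] -/
theorem cellsAt_of_cells (h : PrimeDeterminantCells.CentralCellsDimOne) (t : ℕ) (ht : 1 ≤ t) :
    CellsAt t :=
  cells_iff_forall_cellsAt.mp h t ht

end

end Summit.Parity.GeneralizedHardyLittlewood.Cruxes.CentralCellsDimOne.Strategist
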